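import Literature.ModelTheory.ExponentialFields.DefinableSmoothLocus
import Literature.ModelTheory.ExponentialFields.PilaWilkieParametrizationTools
import Mathlib.Topology.Order.IntermediateValue
import HarnessLib

/-!
# Preparations for the change of the last variable (Bhardwaj–van den Dries 2022, Lemma 6.2), I

Topic `Literature/ModelTheory/ExponentialFields`; proof file in the cone of the named fact
`PilaWilkie2006_thm_1_8`.  Ingredients of the uniform-in-parameters version over `ℝ` of
Bhardwaj–van den Dries 2022, Lemma 6.2 (the analytic heart of the o-minimal Yomdin–Gromov
theorem: *"there is a `(k−1)`-parametrization `Φ` of a cofinite subset of `(0,1)` and a set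
`V ⋐ U` such that for every `φ ∈ Φ`: `I_φ(V) ⊆ U`, `f_φ` is of class `C¹` on `V`, and
`∂f_φ/∂x_i` is strongly bounded on `V`"*):

* `exists_definable_argmax` — definable selection of a maximizer of a definable function on
  the compact members of a definable family (replacing "Definable Selection" for `a_s(t)`),
  from the lexicographic-minimum selector `exists_definableMap_mem_of_isCompact`;
* `interior_preimage_changeLast_eq_empty` — the change of the last variable
  `I_φ(x) = (x', φ(x_{m+1}))` by a continuous strictly monotone `φ` pulls sets with empty
  interior back to sets with empty interior (for `V ⋐ U`);
* `definable_ballSet`, `isCompact_ballSet_fibre` — the sets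
  `U_s(t) = {a | B((a,t), s) ⊆ U_v}` form a definable family with compact members (`s > 0`,
  `U_v ⊆ (0,1)^{m+1}`).

Nothing here is a named fact; no definitions.

## References

* N. Bhardwaj, L. van den Dries, *On the Pila–Wilkie theorem*, Expo. Math. 40 (2022),
  Lemma 6.2 and its proof. [BhardwajVanDenDries2022]
-/

noncomputable section

open Set FirstOrder FirstOrder.Language Filter Topology Function

namespace Literature.ModelTheory.ExponentialFields

/-! ### Preparations for Bhardwaj–van den Dries 2022, Lemma 6.2 -/

section ArgmaxSelector

open Classical

variable {L : Language} [L.Structure ℝ]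

/-- **Definable argmax selection on compact fibres**: for a definable family of sets
`K_w ⊆ ℝ^m` and a definable function `M(w, a)` continuous on each compact `K_w`, there is a
definable selector `a(w)` with `a(w) ∈ K_w` maximizing `M(w, ·)` on `K_w` whenever `K_w` is
compact and non-empty (the argmax set is compact; select its lexicographic minimum,
`exists_definableMap_mem_of_isCompact`).  This replaces "Definable Selection" in
Bhardwaj–van den Dries 2022, proof of Lemma 6.2 (*"we may take `(s,t) ↦ a_s(t)` to be
definable"*). [cite: BhardwajVanDenDries2022, Lemma 6.2 (proof)] -/
theorem exists_definable_argmax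
    (hadd : (univ : Set ℝ).Definable L {v : Fin 3 → ℝ | v 0 + v 1 = v 2})
    (hmul : (univ : Set ℝ).Definable L {v : Fin 3 → ℝ | v 0 * v 1 = v 2})
    {β : Type} [Finite β] {m : ℕ} (K : Set (β ⊕ Fin m → ℝ)) (hK : (univ : Set ℝ).Definable L K)
    (M : (β ⊕ Fin m → ℝ) → ℝ) (hM : (univ : Set ℝ).DefinableFun L M) :
    ∃ sel : (β → ℝ) → (Fin m → ℝ), (univ : Set ℝ).DefinableMap L sel ∧
      ∀ w : β → ℝ, IsCompact {a : Fin m → ℝ | Sum.elim w a ∈ K} →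
        {a : Fin m → ℝ | Sum.elim w a ∈ K}.Nonempty →
        ContinuousOn (fun a => M (Sum.elim w a)) {a : Fin m → ℝ | Sum.elim w a ∈ K} →
          Sum.elim w (sel w) ∈ K ∧ ∀ a, Sum.elim w a ∈ K → M (Sum.elim w a) ≤ M (Sum.elim w (sel w)) := by
  have hlt := definable_lt_of_field hadd hmul
  -- the argmax family
  set S : Set (β ⊕ Fin m → ℝ) := {g | g ∈ K ∧ ∀ a : Fin m → ℝ, Sum.elim (fun b => g (Sum.inl b)) a ∈ K →
      M (Sum.elim (fun b => g (Sum.inl b)) a) ≤ M g} with hS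
  have hSdef : (univ : Set ℝ).Definable L S := by
    refine hK.inter ?_
    apply definable_setOf_forall_block' (β := Fin m) (α := β ⊕ Fin m)
    -- variables `h : (β ⊕ Fin m) ⊕ Fin m → ℝ`
    have hq : (univ : Set ℝ).DefinableMap L (fun (h : (β ⊕ Fin m) ⊕ Fin m → ℝ) (l : β ⊕ Fin m) =>
        (Sum.elim (fun b => h (Sum.inl (Sum.inl b))) (fun j => h (Sum.inr j)) : β ⊕ Fin m → ℝ) l) := by
      intro l; cases l with
      | inl b => exact definableFun_proj _
      | inr j => exact definableFun_proj _
    have hid : (univ : Set ℝ).DefinableMap L (fun (h : (β ⊕ Fin m) ⊕ Fin m → ℝ) (l : β ⊕ Fin m) => h (Sum.inl l)) :=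
      fun l => definableFun_proj _
    refine definable_setOf_imp ?_ ?_
    · have h := hK.preimage_map hq
      convert h using 1
      ext v; exact Iff.rfl
    · have h1 : (univ : Set ℝ).DefinableFun L (fun h : (β ⊕ Fin m) ⊕ Fin m → ℝ =>
          M (Sum.elim (fun b => h (Sum.inl (Sum.inl b))) (fun j => h (Sum.inr j)))) := hM.comp hq
      have h2 : (univ : Set ℝ).DefinableFun L (fun h : (β ⊕ Fin m) ⊕ Fin m → ℝ => M (fun l => h (Sum.inl l))) :=
        hM.comp hid
      have h := definable_setOf_le hlt h1 h2
      convert h using 1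
  obtain ⟨sel, hsel, hmem⟩ := exists_definableMap_mem_of_isCompact hadd hmul m S hSdef
  refine ⟨sel, hsel, fun w hcomp hne hcont => ?_⟩
  -- the argmax fibre is compact and non-empty
  set Kw : Set (Fin m → ℝ) := {a | Sum.elim w a ∈ K} with hKw
  have hfib : {a : Fin m → ℝ | Sum.elim w a ∈ S} = {a ∈ Kw | ∀ a' ∈ Kw, M (Sum.elim w a') ≤ M (Sum.elim w a)} := by
    ext a
    simp only [hS, hKw, mem_setOf_eq]
    constructor
    · rintro ⟨h1, h2⟩
      refine ⟨h1, fun a' ha' => ?_⟩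
      have := h2 a' (by simpa using ha')
      simpa using this
    · rintro ⟨h1, h2⟩
      refine ⟨h1, fun a' ha' => ?_⟩
      have ha'' : Sum.elim w a' ∈ K := by
        convert ha' using 1; funext l; cases l <;> simp
      have := h2 a' ha''
      convert this using 2; funext l; cases l <;> simp
  obtain ⟨a₀, ha₀, hmax⟩ := hcomp.exists_isMaxOn hne hcont
  have hne' : {a : Fin m → ℝ | Sum.elim w a ∈ S}.Nonempty := by
    rw [hfib]; exact ⟨a₀, ha₀, fun a' ha' => hmax ha'⟩
  have hcomp' : IsCompact {a : Fin m → ℝ | Sum.elim w a ∈ S} := by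
    rw [hfib]
    have heq : {a ∈ Kw | ∀ a' ∈ Kw, M (Sum.elim w a') ≤ M (Sum.elim w a)} =
        Kw ∩ (fun a => M (Sum.elim w a)) ⁻¹' Ici (M (Sum.elim w a₀)) := by
      ext a
      simp only [mem_sep_iff, mem_inter_iff, mem_preimage, mem_Ici]
      constructor
      · rintro ⟨h1, h2⟩; exact ⟨h1, h2 a₀ ha₀⟩
      · rintro ⟨h1, h2⟩; exact ⟨h1, fun a' ha' => (hmax ha').trans h2⟩
    rw [heq]
    exact hcomp.of_isClosed_subset (hcont.preimage_isClosed_of_isClosed hcomp.isClosed isClosed_Ici) inter_subset_left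
  have h := hmem w hcomp' hne'
  have h' : sel w ∈ {a : Fin m → ℝ | Sum.elim w a ∈ S} := h
  rw [hfib] at h'
  exact ⟨h'.1, fun a ha => h'.2 a ha⟩

end ArgmaxSelector

/-! ### The change of the last variable does not create interior -/

section ChangeLastOpen

variable {m : ℕ}

/-- **`I_φ` does not create interior**: for `φ` continuous and strictly monotone on `(0,1)`
and `T ⊆ ℝ^{m+1}` with empty interior, the set of `x` with `x_{m+1} ∈ (0,1)` and
`I_φ(x) = (x', φ(x_{m+1})) ∈ T` has empty interior (the image of an open box under `I_φ`
contains an open box, by the intermediate value theorem).  Used for `V ⋐ U` in Bhardwaj–van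
den Dries 2022, Lemma 6.2 (*"The injectivity (and continuity) of the `φ ∈ Φ` gives
`V ⋐ U`"*). [cite: BhardwajVanDenDries2022, Lemma 6.2 (proof)] -/
theorem interior_preimage_changeLast_eq_empty {φ : ℝ → ℝ} (hφc : ContinuousOn φ (Ioo 0 1))
    (hφm : StrictMonoOn φ (Ioo 0 1) ∨ StrictAntiOn φ (Ioo 0 1)) {T : Set (Fin (m + 1) → ℝ)}
    (hT : interior T = ∅) :
    interior {x : Fin (m + 1) → ℝ | x (Fin.last m) ∈ Ioo (0 : ℝ) 1 ∧
      Function.update x (Fin.last m) (φ (x (Fin.last m))) ∈ T} = ∅ := by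
  by_contra hne
  obtain ⟨x, hx⟩ := nonempty_iff_ne_empty.mpr hne
  obtain ⟨a, b, hab, hbox⟩ := exists_box_subset_of_mem_nhds (mem_interior_iff_mem_nhds.mp hx)
  have hxT := interior_subset hx
  -- a closed interval `[α, β]` around `x_{m+1}` inside `(a, b) ∩ (0, 1)`
  set α : ℝ := (max (a (Fin.last m)) 0 + x (Fin.last m)) / 2 with hα
  set β : ℝ := (x (Fin.last m) + min (b (Fin.last m)) 1) / 2 with hβ
  have h1 : max (a (Fin.last m)) 0 < x (Fin.last m) := max_lt (hab _).1 hxT.1.1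
  have h2 : x (Fin.last m) < min (b (Fin.last m)) 1 := lt_min (hab _).2 hxT.1.2
  have hαx : α < x (Fin.last m) := by rw [hα]; linarith
  have hxβ : x (Fin.last m) < β := by rw [hβ]; linarith
  have hαβ : α < β := hαx.trans hxβ
  have hIcc : Icc α β ⊆ Ioo (0 : ℝ) 1 ∩ Ioo (a (Fin.last m)) (b (Fin.last m)) := by
    intro t ht
    have hm1 := le_max_left (a (Fin.last m)) 0
    have hm2 := le_max_right (a (Fin.last m)) 0
    have hm3 := min_le_left (b (Fin.last m)) 1
    have hm4 := min_le_right (b (Fin.last m)) 1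
    refine ⟨⟨?_, ?_⟩, ?_, ?_⟩ <;> [skip; skip; skip; skip] <;> (rw [hα, hβ] at *; rcases ht with ⟨ht1, ht2⟩; linarith)
  have hφI : ContinuousOn φ (Icc α β) := hφc.mono fun t ht => (hIcc ht).1
  -- an open box inside `T`
  have key : ∀ {lo hi : ℝ}, lo < hi → Ioo lo hi ⊆ φ '' Ioo α β → False := by
    intro lo hi hlohi hsub
    apply (nonempty_iff_ne_empty.mp ?_) hT
    refine ⟨Function.update x (Fin.last m) ((lo + hi) / 2), mem_interior.mpr ⟨
      {y | (∀ i : Fin m, a (Fin.castSucc i) < y (Fin.castSucc i) ∧ y (Fin.castSucc i) < b (Fin.castSucc i)) ∧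
        lo < y (Fin.last m) ∧ y (Fin.last m) < hi}, ?_, ?_, ?_⟩⟩
    · -- the box lies in `T`
      rintro y ⟨hy1, hy2, hy3⟩
      obtain ⟨t, ht, hty⟩ := hsub ⟨hy2, hy3⟩
      have hmem : Function.update y (Fin.last m) t ∈ {v : Fin (m + 1) → ℝ | ∀ i, a i < v i ∧ v i < b i} := by
        intro i
        refine Fin.lastCases ?_ (fun j => ?_) i
        · simp only [Function.update_self]; exact (hIcc (Ioo_subset_Icc_self ht)).2
        · rw [Function.update_of_ne (Fin.castSucc_lt_last j).ne]; exact hy1 j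
      have h := hbox hmem
      simp only [mem_setOf_eq, Function.update_self, Function.update_idem] at h
      have : Function.update y (Fin.last m) (φ t) = y := by
        rw [hty]; exact Function.update_eq_self _ _
      rw [this] at h
      exact h.2
    · -- the box is open
      have : {y : Fin (m + 1) → ℝ | (∀ i : Fin m, a (Fin.castSucc i) < y (Fin.castSucc i) ∧ y (Fin.castSucc i) < b (Fin.castSucc i)) ∧
          lo < y (Fin.last m) ∧ y (Fin.last m) < hi} =
          Set.pi univ (Fin.snoc (fun i : Fin m => Ioo (a (Fin.castSucc i)) (b (Fin.castSucc i))) (Ioo lo hi)) := by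
        ext y
        simp only [mem_setOf_eq, Set.mem_pi, Set.mem_univ, forall_const]
        constructor
        · rintro ⟨h1, h2, h3⟩ i
          refine Fin.lastCases ?_ (fun j => ?_) i
          · simp only [Fin.snoc_last]; exact ⟨h2, h3⟩
          · simp only [Fin.snoc_castSucc]; exact h1 j
        · intro h
          refine ⟨fun j => ?_, ?_, ?_⟩
          · have := h (Fin.castSucc j); simp only [Fin.snoc_castSucc] at this; exact this
          · have := h (Fin.last m); simp only [Fin.snoc_last] at this; exact this.1
          · have := h (Fin.last m); simp only [Fin.snoc_last] at this; exact this.2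
      rw [this]
      exact isOpen_set_pi finite_univ fun i _ => by
        refine Fin.lastCases ?_ (fun j => ?_) i
        · simp only [Fin.snoc_last]; exact isOpen_Ioo
        · simp only [Fin.snoc_castSucc]; exact isOpen_Ioo
    · -- the centre belongs to the box
      refine ⟨fun j => ?_, ?_, ?_⟩
      · rw [Function.update_of_ne (Fin.castSucc_lt_last j).ne]; exact hab _
      · simp only [Function.update_self]; linarith
      · simp only [Function.update_self]; linarith
  rcases hφm with hmono | hanti
  · have hlt : φ α < φ β := hmono (hIcc (left_mem_Icc.mpr hαβ.le)).1 (hIcc (right_mem_Icc.mpr hαβ.le)).1 hαβ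
    exact key hlt (intermediate_value_Ioo hαβ.le hφI)
  · have hlt : φ β < φ α := hanti (hIcc (left_mem_Icc.mpr hαβ.le)).1 (hIcc (right_mem_Icc.mpr hαβ.le)).1 hαβ
    exact key hlt (intermediate_value_Ioo' hαβ.le hφI)

end ChangeLastOpen

/-! ### The sets `U_s(t)` of Bhardwaj–van den Dries 2022, Lemma 6.2 -/

section BallSets

open Classical

variable {L : Language} [L.Structure ℝ]

/-- **The family `U_s(t) = {a | the open ball of radius `s` about `(a, t)` lies in `U_v`}`**
(Bhardwaj–van den Dries 2022, proof of Lemma 6.2), as a definable set of tuples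
`((v, s), t; a)` indexed by `(Fin (p+1) ⊕ Unit) ⊕ Fin m` (sup metric).
[cite: BhardwajVanDenDries2022, Lemma 6.2 (proof)] -/
theorem definable_ballSet {p m : ℕ}
    (hadd : (univ : Set ℝ).Definable L {v : Fin 3 → ℝ | v 0 + v 1 = v 2})
    (hmul : (univ : Set ℝ).Definable L {v : Fin 3 → ℝ | v 0 * v 1 = v 2})
    {U : Set (Fin (p + (m + 1)) → ℝ)} (hU : (univ : Set ℝ).Definable L U) :
    (univ : Set ℝ).Definable L {g : (Fin (p + 1) ⊕ Unit) ⊕ Fin m → ℝ |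
      ∀ y : Fin (m + 1) → ℝ,
        (∀ i : Fin (m + 1), y i - (Fin.snoc (fun j => g (Sum.inr j)) (g (Sum.inl (Sum.inr ()))) : Fin (m + 1) → ℝ) i <
            g (Sum.inl (Sum.inl (Fin.last p))) ∧
          (Fin.snoc (fun j => g (Sum.inr j)) (g (Sum.inl (Sum.inr ()))) : Fin (m + 1) → ℝ) i - y i <
            g (Sum.inl (Sum.inl (Fin.last p)))) →
        (Fin.append (fun j : Fin p => g (Sum.inl (Sum.inl (Fin.castSucc j)))) y :) ∈ U} := by
  have hlt := definable_lt_of_field hadd hmul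
  apply definable_setOf_forall_block' (β := Fin (m + 1))
  -- variables `h : ((Fin (p+1) ⊕ Unit) ⊕ Fin m) ⊕ Fin (m+1) → ℝ`
  have hcentre : ∀ i : Fin (m + 1), (univ : Set ℝ).DefinableFun L
      (fun h : ((Fin (p + 1) ⊕ Unit) ⊕ Fin m) ⊕ Fin (m + 1) → ℝ =>
        (Fin.snoc (fun j => h (Sum.inl (Sum.inr j))) (h (Sum.inl (Sum.inl (Sum.inr ())))) : Fin (m + 1) → ℝ) i) := by
    intro i
    refine Fin.lastCases ?_ (fun j => ?_) i
    · simp only [Fin.snoc_last]; exact definableFun_proj _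
    · simp only [Fin.snoc_castSucc]; exact definableFun_proj _
  refine definable_setOf_imp ?_ ?_
  · have h := definable_iInter_of_finite (L := L) (A := (univ : Set ℝ))
      (f := fun i : Fin (m + 1) => {h : ((Fin (p + 1) ⊕ Unit) ⊕ Fin m) ⊕ Fin (m + 1) → ℝ |
        h (Sum.inr i) - (Fin.snoc (fun j => h (Sum.inl (Sum.inr j))) (h (Sum.inl (Sum.inl (Sum.inr ())))) : Fin (m + 1) → ℝ) i <
            h (Sum.inl (Sum.inl (Sum.inl (Fin.last p)))) ∧
          (Fin.snoc (fun j => h (Sum.inl (Sum.inr j))) (h (Sum.inl (Sum.inl (Sum.inr ())))) : Fin (m + 1) → ℝ) i - h (Sum.inr i) <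
            h (Sum.inl (Sum.inl (Sum.inl (Fin.last p))))})
      (fun i => definable_setOf_and
        (definable_setOf_lt hlt (definableFun_sub hadd (definableFun_proj _) (hcentre i)) (definableFun_proj _))
        (definable_setOf_lt hlt (definableFun_sub hadd (hcentre i) (definableFun_proj _)) (definableFun_proj _)))
    convert h using 1
    ext h; simp only [mem_iInter, mem_setOf_eq]
  · set κ : Fin (p + (m + 1)) → ((Fin (p + 1) ⊕ Unit) ⊕ Fin m) ⊕ Fin (m + 1) :=
      Fin.addCases (fun j => Sum.inl (Sum.inl (Sum.inl (Fin.castSucc j)))) (fun i => Sum.inr i) with hκ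
    have h := hU.preimage_comp κ
    convert h using 1
    ext h
    show _ ↔ (h ∘ κ) ∈ U
    have : (h ∘ κ) = Fin.append (fun j : Fin p => h (Sum.inl (Sum.inl (Sum.inl (Fin.castSucc j))))) (fun i => h (Sum.inr i)) := by
      funext l; refine Fin.addCases (fun j => ?_) (fun i => ?_) l <;> simp [hκ]
    rw [this]; rfl

/-- **`U_s(t)` is compact** for `s > 0` when `U_v ⊆ (0,1)^{m+1}`: closed (its complement is a
union of open conditions) and bounded (`a ∈ U_s(t)` puts `(a, t)` in `U_v`). Here stated for
the fibre `{a | ∀ y, ‖y − (a,t)‖_∞ < s → (v, y) ∈ U}`. [cite: BhardwajVanDenDries2022, Lemma 6.2 (proof)] -/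
theorem isCompact_ballSet_fibre {p m : ℕ} {U : Set (Fin (p + (m + 1)) → ℝ)} (v : Fin p → ℝ)
    (hUsub : {x : Fin (m + 1) → ℝ | (Fin.append v x :) ∈ U} ⊆ Set.pi univ fun _ => Ioo (0 : ℝ) 1)
    {s : ℝ} (hs : 0 < s) (t : ℝ) :
    IsCompact {a : Fin m → ℝ | ∀ y : Fin (m + 1) → ℝ,
      (∀ i, y i - (Fin.snoc a t : Fin (m + 1) → ℝ) i < s ∧ (Fin.snoc a t : Fin (m + 1) → ℝ) i - y i < s) →
        (Fin.append v y :) ∈ U} := by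
  apply Metric.isCompact_of_isClosed_isBounded
  · -- closed: the complement is open
    rw [← isOpen_compl_iff, isOpen_iff_forall_mem_open]
    intro a ha
    simp only [mem_compl_iff, mem_setOf_eq, not_forall, exists_prop] at ha
    obtain ⟨y, hy, hyU⟩ := ha
    -- room `ρ = s - ‖y - (a,t)‖`
    have hfin : ∀ i, |y i - (Fin.snoc a t : Fin (m + 1) → ℝ) i| < s := fun i => by
      rw [abs_sub_lt_iff]; exact ⟨(hy i).1, (hy i).2⟩
    obtain ⟨ρ, hρ, hρs⟩ : ∃ ρ > 0, ∀ i, |y i - (Fin.snoc a t : Fin (m + 1) → ℝ) i| + ρ < s := by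
      have hne : (Finset.univ.image fun i : Fin (m + 1) => |y i - (Fin.snoc a t : Fin (m + 1) → ℝ) i|).Nonempty :=
        ⟨_, Finset.mem_image.mpr ⟨Fin.last m, Finset.mem_univ _, rfl⟩⟩
      set M := (Finset.univ.image fun i : Fin (m + 1) => |y i - (Fin.snoc a t : Fin (m + 1) → ℝ) i|).max' hne with hM
      have hMs : M < s := by
        obtain ⟨i, -, hi⟩ := Finset.mem_image.mp (Finset.max'_mem _ hne)
        rw [hM, ← hi]; exact hfin i
      refine ⟨(s - M) / 2, by linarith, fun i => ?_⟩
      have : |y i - (Fin.snoc a t : Fin (m + 1) → ℝ) i| ≤ M := by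
        rw [hM]
        exact Finset.le_max' (Finset.univ.image fun i : Fin (m + 1) => |y i - (Fin.snoc a t : Fin (m + 1) → ℝ) i|) _
          (Finset.mem_image.mpr ⟨i, Finset.mem_univ _, rfl⟩)
      linarith
    refine ⟨Metric.ball a ρ, fun a' ha' => ?_, Metric.isOpen_ball, Metric.mem_ball_self hρ⟩
    simp only [mem_compl_iff, mem_setOf_eq, not_forall, exists_prop]
    refine ⟨y, fun i => ?_, hyU⟩
    have hd : dist a' a < ρ := ha'
    have hi : |(Fin.snoc a' t : Fin (m + 1) → ℝ) i - (Fin.snoc a t : Fin (m + 1) → ℝ) i| < ρ := by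
      refine Fin.lastCases ?_ (fun j => ?_) i
      · simp [hρ]
      · simp only [Fin.snoc_castSucc]
        rw [← Real.dist_eq]
        exact (dist_le_pi_dist a' a j).trans_lt hd
    have h := hρs i
    rw [abs_sub_lt_iff] at hi
    have h1 := le_abs_self (y i - (Fin.snoc a t : Fin (m + 1) → ℝ) i)
    have h2 := neg_abs_le (y i - (Fin.snoc a t : Fin (m + 1) → ℝ) i)
    constructor <;> linarith [hi.1, hi.2]
  · -- bounded: inside the unit cube
    refine (Metric.isBounded_Icc (0 : Fin m → ℝ) 1).subset fun a ha => ?_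
    have hmem : (Fin.append v (Fin.snoc a t) :) ∈ U := ha (Fin.snoc a t) fun i => by
      constructor <;> linarith
    have hcube := hUsub hmem
    rw [mem_Icc]
    constructor <;> intro j
    · have := (hcube (Fin.castSucc j) (mem_univ _)).1; simp only [Fin.snoc_castSucc] at this; exact this.le
    · have := (hcube (Fin.castSucc j) (mem_univ _)).2; simp only [Fin.snoc_castSucc] at this; exact this.le

end BallSets


end Literature.ModelTheory.ExponentialFields

end
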